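import Literature.Geometry.DiscreteGeometry.KissingRigidity
import Summits.AtomisticToContinuum.Crystallization.Theorems.SquareWellLayerCakeGapTwelveToBarlowFiveRingCensusDefs
import Summits.AtomisticToContinuum.Crystallization.Theorems.SquareWellLayerCakeGapTwelveToBarlowFiveFoldLinearChains

/-!
# Linear five-fold count: the typed reduction to the curvature ration (S2γ of the `Sketch` line)

Crux `SquareWellLayerCake.GapTwelveToBarlow` (stmt-AtomisticToContinuum-15807), line `Sketch`, stub
`stub_fiveFoldLinear` (card A proper): under (ExtendedGap) and (Continuation) there are absolute
`C`, `D₀` such that every site with an all-Good `2D`-ball, `D ≥ D₀`, has at most `C·D` sites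
within `D` carrying a five-fold bond.

Wave 3 (`…GapTwelveToBarlowFiveFoldLinearChains`, `stub_fiveFoldChains`) proved the combinatorial
half: deep five-fold sites have five-fold degree `0` or `2` with nearly opposite bonds, so the
five-fold bonds of the deep region form disjoint chains.  How STRAIGHT a chain is, is not a
link-level fact (a chain may curl by `≈ (1 - 55/57)/(2s)` radians per step while all-Good to
transverse depth `s`); the linear count is a statement of comparison geometry on the regular
tetrahedron/octahedron complex `X` of the deep region — a polyhedral `3`-space of curvature `≥ 0`
whose singular set is the union of the chains, each five-fold edge carrying the angular deficit
`Ω = 2π - 5 arccos (1/3)`, every chain an `X`-geodesic — the CURVATURE RATION `(S3γ)` below.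
This file records the reduction of the stub to three CLOSED residual statements, written in the
crux's finite language (plus the Literature contact relations `fccAdj`, `hcpAdj` and the census
lane's `bppAdj`):

* `(S3β)` OCTAHEDRAL COMPLETION (cell zoo at a bond, six-deep; certified enumeration, or
  chart-chasing from `(S3δ)`): the common neighbours of a bonded pair `(j,k)` span exactly two
  bonds when they are four (edge words `TOTO`, `TTOO`; the words `TOOO`, `OOOO`, `TTTO` do not
  close up in `ℝ³` within the window, numerical margin `≥ 0.027`), and when they are at most four
  any two of them at distance in `(1, 38/25]` complete to an octahedron `{j, k, l, l', m, m'}`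
  (`m` opposite `j`, `m'` opposite `k`).  The threshold `38/25` separates `O`-pairs (octahedron
  diagonals `≤ 1.465`; a planar bonded `4`-gon has diagonals `≤ √(4 - 1.31²) < 38/25`) from the
  apex pair of two face-sharing tetrahedra (`≥ 2 √((55/57)² - 1/3) > 1.546`), a `T|O`-opposite
  pair (`≥ 1.64`) and a ring chord of a five-fold bond (`≥ 1.53`).
* `(S3δ)` the ONE-SHELL LINK CENSUS (certified enumeration with the tree's gapped-shell replayer;
  it is hypothesis `P1` of `stub_combinatorialLayering` together with the five-ring census of the
  S2β lane): the twelve neighbours of a Good site carrying the local `131/100` dichotomy have, in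
  some labelling `e : Fin 12 → Fin N`, exactly the contact graph of the cuboctahedron (`fccAdj`),
  the anticuboctahedron (`hcpAdj`) or the bicapped pentagonal prism (`bppAdj`).  This is what
  `(S3γ)` needs beyond `(S3β)`: it excludes bonds with at most three common neighbours and every
  exotic link — nothing short of the census does that at these constants — and makes all cell
  bookkeeping of `(S3γ)` combinatorial (it also yields (Continuation) except for the unused angle
  bound, which is why `(S3γ)` does not take (Continuation) as a hypothesis).
* `(S3γ)` the CURVATURE RATION proper (XL; Alexandrov gluing for polyhedra, and a Petrunin-type
  bound `∫_{B_r} Sc ≤ C(3)·r` for the scalar-curvature measure `Ω·(five-fold length)` of a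
  `CBB(0)` polyhedral `3`-space, transported to `ℝ³` by the cellwise-affine comparison map):
  (ExtendedGap) → (conclusion of S3β) → (S3δ at ten-deep sites) → the stub's conclusion verbatim.
  Purely geometric given its hypotheses.

`stub_fiveFoldLinear_of_parts : (S3β) → (S3δ) → (S3γ) → stub_fiveFoldLinear` is application
plus the bookkeeping `census_of_deep` (anchor of this file: a ten-deep site of an all-Good
`2D`-ball is Good and, by (ExtendedGap), carries the local dichotomy — `localGap_of_deep` of the
chains file — so `(S3δ)` applies to it); `stub_fiveFoldLinear_of_deepParts` is the same with the
census already in deep form, into which any multi-shell census bridges.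

Nothing is defined; no named fact is used.
-/

namespace Summit.AtomisticToContinuum.Crystallization.Theorems.SquareWellLayerCakeGapTwelveToBarlow

/-! ## Bookkeeping: the census at deep sites of an all-Good ball -/

/-- **`(S3δ)` transported to deep sites** (anchor of this file).  Under (ExtendedGap), if the
one-shell link census holds at every Good site carrying the local `131/100` dichotomy, then every
site `j` with `dist (x i) (x j) + 10 ≤ 2D` of an all-Good `2D`-ball about `x i` has a
cuboctahedral, anticuboctahedral or bicapped-pentagonal-prism labelling of its twelve
neighbours. [folklore] -/
theorem census_of_deep :
    (∀ (N : ℕ) (x : Fin N → EuclideanSpace ℝ (Fin 3)) (i j : Fin N), (∀ l : Fin N, dist (x i)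
      (x l) ≤ 4 → ((∀ j' : Fin N, dist (x l) (x j') ≤ 11 / 10 → ∀ k : Fin N, k ≠ j' → (55 : ℝ) /
      57 ≤ dist (x j') (x k)) ∧ (Finset.univ.filter fun j' : Fin N => j' ≠ l ∧ dist (x l) (x j')
      ≤ 1).card = 12 ∧ (Finset.univ.filter fun j' : Fin N => j' ≠ l ∧ dist (x l) (x j') ≤ 11 /
      10).card ≤ 12)) → 1 < dist (x i) (x j) → (131 : ℝ) / 100 ≤ dist (x i) (x j)) →
    (∀ (N : ℕ) (x : Fin N → EuclideanSpace ℝ (Fin 3)) (j : Fin N), ((∀ j' : Fin N, dist (x j)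
      (x j') ≤ 11 / 10 → ∀ k' : Fin N, k' ≠ j' → (55 : ℝ) / 57 ≤ dist (x j') (x k')) ∧
      (Finset.univ.filter fun j' : Fin N => j' ≠ j ∧ dist (x j) (x j') ≤ 1).card = 12 ∧
      (Finset.univ.filter fun j' : Fin N => j' ≠ j ∧ dist (x j) (x j') ≤ 11 / 10).card ≤ 12) →
      (∀ l l' : Fin N, dist (x j) (x l) ≤ 1 → dist (x j) (x l') ≤ 1 → 1 < dist (x l) (x l') →
      (131 : ℝ) / 100 ≤ dist (x l) (x l')) → ∃ e : Fin 12 → Fin N, Function.Injective e ∧ (∀ a :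
      Fin 12, e a ≠ j ∧ dist (x j) (x (e a)) ≤ 1) ∧ ((∀ a b : Fin 12, a ≠ b → (dist (x (e a)) (x
      (e b)) ≤ 1 ↔ Literature.Geometry.DiscreteGeometry.fccAdj a b)) ∨ (∀ a b : Fin 12, a ≠ b →
      (dist (x (e a)) (x (e b)) ≤ 1 ↔ Literature.Geometry.DiscreteGeometry.hcpAdj a b)) ∨ (∀ a b
      : Fin 12, a ≠ b → (dist (x (e a)) (x (e b)) ≤ 1 ↔
      Summit.AtomisticToContinuum.Crystallization.Theorems.SquareWellLayerCakeGapTwelveToBarlow.bppAdj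
      a b = true)))) →
    ∀ (N : ℕ) (x : Fin N → EuclideanSpace ℝ (Fin 3)) (i : Fin N) (D : ℝ), (∀ j : Fin N, dist (x
    i) (x j) ≤ 2 * D → ((∀ j' : Fin N, dist (x j) (x j') ≤ 11 / 10 → ∀ k : Fin N, k ≠ j' → (55 :
    ℝ) / 57 ≤ dist (x j') (x k)) ∧ (Finset.univ.filter fun j' : Fin N => j' ≠ j ∧ dist (x j) (x
    j') ≤ 1).card = 12 ∧ (Finset.univ.filter fun j' : Fin N => j' ≠ j ∧ dist (x j) (x j') ≤ 11 /
    10).card ≤ 12)) → ∀ j : Fin N, dist (x i) (x j) + 10 ≤ 2 * D → ∃ e : Fin 12 → Fin N,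
    Function.Injective e ∧ (∀ a : Fin 12, e a ≠ j ∧ dist (x j) (x (e a)) ≤ 1) ∧ ((∀ a b : Fin
    12, a ≠ b → (dist (x (e a)) (x (e b)) ≤ 1 ↔ Literature.Geometry.DiscreteGeometry.fccAdj a
    b)) ∨ (∀ a b : Fin 12, a ≠ b → (dist (x (e a)) (x (e b)) ≤ 1 ↔
    Literature.Geometry.DiscreteGeometry.hcpAdj a b)) ∨ (∀ a b : Fin 12, a ≠ b → (dist (x (e a))
    (x (e b)) ≤ 1 ↔
    Summit.AtomisticToContinuum.Crystallization.Theorems.SquareWellLayerCakeGapTwelveToBarlow.bppAdj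
    a b = true))) :=
  fun hGap hCensus _ x i D hGood j hj =>
    hCensus _ x j (hGood j (by linarith [dist_nonneg (x := x i) (y := x j)]))
      (localGap_of_deep hGap x i D hGood j (by linarith))

/-! ## The typed reduction -/

/-- **`stub_fiveFoldLinear` from its three residuals** (wave 4 of the `Sketch` line).
Hypotheses, in order:

1. `(S3β)` octahedral completion, six-deep: (ExtendedGap) → for every all-Good `2D`-ball about
   `x i` and every bonded pair `(j,k)` with `dist (x i) (x j) + 6 ≤ 2D`: if `j`, `k` have exactly
   four common neighbours, these span exactly two bonds (the sum of their inner degrees is `4`);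
   if they have at most four, any two of them at distance in `(1, 38/25]` complete, with `j`, `k`
   and two further sites `m ~ k, l, l'`, `m' ~ j, l, l'` (`m ≁ j`, `m' ≁ k`, `m ~ m'`), to an
   octahedron;
2. `(S3δ)` the one-shell link census: Good + local `131/100` dichotomy ⇒ the contact graph of
   the twelve neighbours is, in some labelling `e : Fin 12 → Fin N`, `fccAdj`, `hcpAdj` or
   `bppAdj`;
3. `(S3γ)` the curvature ration (comparison geometry, open, XL):
   (ExtendedGap) → (conclusion of 1) → (2 at ten-deep sites) → linear five-fold count.

Conclusion: the registered signature of `stub_fiveFoldLinear`, verbatim ((Continuation) is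
carried but not needed). [folklore] -/
theorem stub_fiveFoldLinear_of_parts :
    ((∀ (N : ℕ) (x : Fin N → EuclideanSpace ℝ (Fin 3)) (i j : Fin N), (∀ l : Fin N, dist (x i)
      (x l) ≤ 4 → ((∀ j' : Fin N, dist (x l) (x j') ≤ 11 / 10 → ∀ k : Fin N, k ≠ j' → (55 : ℝ) /
      57 ≤ dist (x j') (x k)) ∧ (Finset.univ.filter fun j' : Fin N => j' ≠ l ∧ dist (x l) (x j')
      ≤ 1).card = 12 ∧ (Finset.univ.filter fun j' : Fin N => j' ≠ l ∧ dist (x l) (x j') ≤ 11 /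
      10).card ≤ 12)) → 1 < dist (x i) (x j) → (131 : ℝ) / 100 ≤ dist (x i) (x j)) → ∀ (N : ℕ)
      (x : Fin N → EuclideanSpace ℝ (Fin 3)) (i : Fin N) (D : ℝ), (∀ j : Fin N, dist (x i) (x j)
      ≤ 2 * D → ((∀ j' : Fin N, dist (x j) (x j') ≤ 11 / 10 → ∀ k : Fin N, k ≠ j' → (55 : ℝ) /
      57 ≤ dist (x j') (x k)) ∧ (Finset.univ.filter fun j' : Fin N => j' ≠ j ∧ dist (x j) (x j')
      ≤ 1).card = 12 ∧ (Finset.univ.filter fun j' : Fin N => j' ≠ j ∧ dist (x j) (x j') ≤ 11 /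
      10).card ≤ 12)) → ∀ j k : Fin N, dist (x i) (x j) + 6 ≤ 2 * D → j ≠ k → dist (x j) (x k) ≤
      1 → ((Finset.univ.filter fun l : Fin N => l ≠ j ∧ l ≠ k ∧ dist (x j) (x l) ≤ 1 ∧ dist (x
      k) (x l) ≤ 1).card = 4 → (∑ l ∈ (Finset.univ.filter fun l : Fin N => l ≠ j ∧ l ≠ k ∧ dist
      (x j) (x l) ≤ 1 ∧ dist (x k) (x l) ≤ 1), ((Finset.univ.filter fun l : Fin N => l ≠ j ∧ l ≠
      k ∧ dist (x j) (x l) ≤ 1 ∧ dist (x k) (x l) ≤ 1).filter fun l' : Fin N => l' ≠ l ∧ dist (x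
      l) (x l') ≤ 1).card) = 4) ∧ ((Finset.univ.filter fun l : Fin N => l ≠ j ∧ l ≠ k ∧ dist (x
      j) (x l) ≤ 1 ∧ dist (x k) (x l) ≤ 1).card ≤ 4 → ∀ l ∈ (Finset.univ.filter fun l : Fin N =>
      l ≠ j ∧ l ≠ k ∧ dist (x j) (x l) ≤ 1 ∧ dist (x k) (x l) ≤ 1), ∀ l' ∈ (Finset.univ.filter
      fun l : Fin N => l ≠ j ∧ l ≠ k ∧ dist (x j) (x l) ≤ 1 ∧ dist (x k) (x l) ≤ 1), 1 < dist (x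
      l) (x l') → dist (x l) (x l') ≤ (38 : ℝ) / 25 → ∃ m m' : Fin N, dist (x m) (x m') ≤ 1 ∧ 1
      < dist (x j) (x m) ∧ dist (x k) (x m) ≤ 1 ∧ dist (x l) (x m) ≤ 1 ∧ dist (x l') (x m) ≤ 1 ∧
      1 < dist (x k) (x m') ∧ dist (x j) (x m') ≤ 1 ∧ dist (x l) (x m') ≤ 1 ∧ dist (x l') (x m')
      ≤ 1)) →
    (∀ (N : ℕ) (x : Fin N → EuclideanSpace ℝ (Fin 3)) (j : Fin N), ((∀ j' : Fin N, dist (x j)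
      (x j') ≤ 11 / 10 → ∀ k' : Fin N, k' ≠ j' → (55 : ℝ) / 57 ≤ dist (x j') (x k')) ∧
      (Finset.univ.filter fun j' : Fin N => j' ≠ j ∧ dist (x j) (x j') ≤ 1).card = 12 ∧
      (Finset.univ.filter fun j' : Fin N => j' ≠ j ∧ dist (x j) (x j') ≤ 11 / 10).card ≤ 12) →
      (∀ l l' : Fin N, dist (x j) (x l) ≤ 1 → dist (x j) (x l') ≤ 1 → 1 < dist (x l) (x l') →
      (131 : ℝ) / 100 ≤ dist (x l) (x l')) → ∃ e : Fin 12 → Fin N, Function.Injective e ∧ (∀ a :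
      Fin 12, e a ≠ j ∧ dist (x j) (x (e a)) ≤ 1) ∧ ((∀ a b : Fin 12, a ≠ b → (dist (x (e a)) (x
      (e b)) ≤ 1 ↔ Literature.Geometry.DiscreteGeometry.fccAdj a b)) ∨ (∀ a b : Fin 12, a ≠ b →
      (dist (x (e a)) (x (e b)) ≤ 1 ↔ Literature.Geometry.DiscreteGeometry.hcpAdj a b)) ∨ (∀ a b
      : Fin 12, a ≠ b → (dist (x (e a)) (x (e b)) ≤ 1 ↔
      Summit.AtomisticToContinuum.Crystallization.Theorems.SquareWellLayerCakeGapTwelveToBarlow.bppAdj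
      a b = true)))) →
    ((∀ (N : ℕ) (x : Fin N → EuclideanSpace ℝ (Fin 3)) (i j : Fin N), (∀ l : Fin N, dist (x i)
      (x l) ≤ 4 → ((∀ j' : Fin N, dist (x l) (x j') ≤ 11 / 10 → ∀ k : Fin N, k ≠ j' → (55 : ℝ) /
      57 ≤ dist (x j') (x k)) ∧ (Finset.univ.filter fun j' : Fin N => j' ≠ l ∧ dist (x l) (x j')
      ≤ 1).card = 12 ∧ (Finset.univ.filter fun j' : Fin N => j' ≠ l ∧ dist (x l) (x j') ≤ 11 /
      10).card ≤ 12)) → 1 < dist (x i) (x j) → (131 : ℝ) / 100 ≤ dist (x i) (x j)) → (∀ (N : ℕ)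
      (x : Fin N → EuclideanSpace ℝ (Fin 3)) (i : Fin N) (D : ℝ), (∀ j : Fin N, dist (x i) (x j)
      ≤ 2 * D → ((∀ j' : Fin N, dist (x j) (x j') ≤ 11 / 10 → ∀ k : Fin N, k ≠ j' → (55 : ℝ) /
      57 ≤ dist (x j') (x k)) ∧ (Finset.univ.filter fun j' : Fin N => j' ≠ j ∧ dist (x j) (x j')
      ≤ 1).card = 12 ∧ (Finset.univ.filter fun j' : Fin N => j' ≠ j ∧ dist (x j) (x j') ≤ 11 /
      10).card ≤ 12)) → ∀ j k : Fin N, dist (x i) (x j) + 6 ≤ 2 * D → j ≠ k → dist (x j) (x k) ≤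
      1 → ((Finset.univ.filter fun l : Fin N => l ≠ j ∧ l ≠ k ∧ dist (x j) (x l) ≤ 1 ∧ dist (x
      k) (x l) ≤ 1).card = 4 → (∑ l ∈ (Finset.univ.filter fun l : Fin N => l ≠ j ∧ l ≠ k ∧ dist
      (x j) (x l) ≤ 1 ∧ dist (x k) (x l) ≤ 1), ((Finset.univ.filter fun l : Fin N => l ≠ j ∧ l ≠
      k ∧ dist (x j) (x l) ≤ 1 ∧ dist (x k) (x l) ≤ 1).filter fun l' : Fin N => l' ≠ l ∧ dist (x
      l) (x l') ≤ 1).card) = 4) ∧ ((Finset.univ.filter fun l : Fin N => l ≠ j ∧ l ≠ k ∧ dist (x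
      j) (x l) ≤ 1 ∧ dist (x k) (x l) ≤ 1).card ≤ 4 → ∀ l ∈ (Finset.univ.filter fun l : Fin N =>
      l ≠ j ∧ l ≠ k ∧ dist (x j) (x l) ≤ 1 ∧ dist (x k) (x l) ≤ 1), ∀ l' ∈ (Finset.univ.filter
      fun l : Fin N => l ≠ j ∧ l ≠ k ∧ dist (x j) (x l) ≤ 1 ∧ dist (x k) (x l) ≤ 1), 1 < dist (x
      l) (x l') → dist (x l) (x l') ≤ (38 : ℝ) / 25 → ∃ m m' : Fin N, dist (x m) (x m') ≤ 1 ∧ 1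
      < dist (x j) (x m) ∧ dist (x k) (x m) ≤ 1 ∧ dist (x l) (x m) ≤ 1 ∧ dist (x l') (x m) ≤ 1 ∧
      1 < dist (x k) (x m') ∧ dist (x j) (x m') ≤ 1 ∧ dist (x l) (x m') ≤ 1 ∧ dist (x l') (x m')
      ≤ 1)) → (∀ (N : ℕ) (x : Fin N → EuclideanSpace ℝ (Fin 3)) (i : Fin N) (D : ℝ), (∀ j : Fin
      N, dist (x i) (x j) ≤ 2 * D → ((∀ j' : Fin N, dist (x j) (x j') ≤ 11 / 10 → ∀ k : Fin N, k
      ≠ j' → (55 : ℝ) / 57 ≤ dist (x j') (x k)) ∧ (Finset.univ.filter fun j' : Fin N => j' ≠ j ∧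
      dist (x j) (x j') ≤ 1).card = 12 ∧ (Finset.univ.filter fun j' : Fin N => j' ≠ j ∧ dist (x
      j) (x j') ≤ 11 / 10).card ≤ 12)) → ∀ j : Fin N, dist (x i) (x j) + 10 ≤ 2 * D → ∃ e : Fin
      12 → Fin N, Function.Injective e ∧ (∀ a : Fin 12, e a ≠ j ∧ dist (x j) (x (e a)) ≤ 1) ∧
      ((∀ a b : Fin 12, a ≠ b → (dist (x (e a)) (x (e b)) ≤ 1 ↔
      Literature.Geometry.DiscreteGeometry.fccAdj a b)) ∨ (∀ a b : Fin 12, a ≠ b → (dist (x (e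
      a)) (x (e b)) ≤ 1 ↔ Literature.Geometry.DiscreteGeometry.hcpAdj a b)) ∨ (∀ a b : Fin 12, a
      ≠ b → (dist (x (e a)) (x (e b)) ≤ 1 ↔
      Summit.AtomisticToContinuum.Crystallization.Theorems.SquareWellLayerCakeGapTwelveToBarlow.bppAdj
      a b = true)))) → ∃ C D₀ : ℝ, ∀ (N : ℕ) (x : Fin N → EuclideanSpace ℝ (Fin 3)) (i : Fin N)
      (D : ℝ), D₀ ≤ D → (∀ j : Fin N, dist (x i) (x j) ≤ 2 * D → ((∀ j' : Fin N, dist (x j) (x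
      j') ≤ 11 / 10 → ∀ k : Fin N, k ≠ j' → (55 : ℝ) / 57 ≤ dist (x j') (x k)) ∧
      (Finset.univ.filter fun j' : Fin N => j' ≠ j ∧ dist (x j) (x j') ≤ 1).card = 12 ∧
      (Finset.univ.filter fun j' : Fin N => j' ≠ j ∧ dist (x j) (x j') ≤ 11 / 10).card ≤ 12)) →
      ((Finset.univ.filter fun j : Fin N => dist (x i) (x j) ≤ D ∧ ∃ k : Fin N, j ≠ k ∧ dist (x
      j) (x k) ≤ 1 ∧ (Finset.univ.filter fun l : Fin N => l ≠ j ∧ l ≠ k ∧ dist (x j) (x l) ≤ 1 ∧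
      dist (x k) (x l) ≤ 1).card = 5).card : ℝ) ≤ C * D) →
    (∀ (N : ℕ) (x : Fin N → EuclideanSpace ℝ (Fin 3)) (i j : Fin N), (∀ l : Fin N, dist (x i) (x
    l) ≤ 4 → ((∀ j' : Fin N, dist (x l) (x j') ≤ 11 / 10 → ∀ k : Fin N, k ≠ j' → (55 : ℝ) / 57 ≤
    dist (x j') (x k)) ∧ (Finset.univ.filter fun j' : Fin N => j' ≠ l ∧ dist (x l) (x j') ≤
    1).card = 12 ∧ (Finset.univ.filter fun j' : Fin N => j' ≠ l ∧ dist (x l) (x j') ≤ 11 /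
    10).card ≤ 12)) → 1 < dist (x i) (x j) → (131 : ℝ) / 100 ≤ dist (x i) (x j)) → (∀ (N : ℕ) (x
    : Fin N → EuclideanSpace ℝ (Fin 3)) (j k : Fin N), ((∀ j' : Fin N, dist (x j) (x j') ≤ 11 /
    10 → ∀ k' : Fin N, k' ≠ j' → (55 : ℝ) / 57 ≤ dist (x j') (x k')) ∧ (Finset.univ.filter fun
    j' : Fin N => j' ≠ j ∧ dist (x j) (x j') ≤ 1).card = 12 ∧ (Finset.univ.filter fun j' : Fin N
    => j' ≠ j ∧ dist (x j) (x j') ≤ 11 / 10).card ≤ 12) → (∀ l l' : Fin N, dist (x j) (x l) ≤ 1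
    → dist (x j) (x l') ≤ 1 → 1 < dist (x l) (x l') → (131 : ℝ) / 100 ≤ dist (x l) (x l')) → j ≠
    k → dist (x j) (x k) ≤ 1 → (Finset.univ.filter fun l : Fin N => l ≠ j ∧ l ≠ k ∧ dist (x j)
    (x l) ≤ 1 ∧ dist (x k) (x l) ≤ 1).card = 5 → (Finset.univ.filter fun k' : Fin N => k' ≠ j ∧
    dist (x j) (x k') ≤ 1 ∧ (Finset.univ.filter fun l : Fin N => l ≠ j ∧ l ≠ k' ∧ dist (x j) (x
    l) ≤ 1 ∧ dist (x k') (x l) ≤ 1).card = 5).card = 2 ∧ ∀ k' : Fin N, k' ≠ j → dist (x j) (x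
    k') ≤ 1 → (Finset.univ.filter fun l : Fin N => l ≠ j ∧ l ≠ k' ∧ dist (x j) (x l) ≤ 1 ∧ dist
    (x k') (x l) ≤ 1).card = 5 → k' ≠ k → inner ℝ (x k - x j) (x k' - x j) ≤ -((19 : ℝ) / 20) *
    (‖x k - x j‖ * ‖x k' - x j‖)) → ∃ C D₀ : ℝ, ∀ (N : ℕ) (x : Fin N → EuclideanSpace ℝ (Fin 3))
    (i : Fin N) (D : ℝ), D₀ ≤ D → (∀ j : Fin N, dist (x i) (x j) ≤ 2 * D → ((∀ j' : Fin N, dist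
    (x j) (x j') ≤ 11 / 10 → ∀ k : Fin N, k ≠ j' → (55 : ℝ) / 57 ≤ dist (x j') (x k)) ∧
    (Finset.univ.filter fun j' : Fin N => j' ≠ j ∧ dist (x j) (x j') ≤ 1).card = 12 ∧
    (Finset.univ.filter fun j' : Fin N => j' ≠ j ∧ dist (x j) (x j') ≤ 11 / 10).card ≤ 12)) →
    ((Finset.univ.filter fun j : Fin N => dist (x i) (x j) ≤ D ∧ ∃ k : Fin N, j ≠ k ∧ dist (x j)
    (x k) ≤ 1 ∧ (Finset.univ.filter fun l : Fin N => l ≠ j ∧ l ≠ k ∧ dist (x j) (x l) ≤ 1 ∧ dist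
    (x k) (x l) ≤ 1).card = 5).card : ℝ) ≤ C * D :=
  fun hβ hC hγ hGap _ => hγ hGap (hβ hGap) (census_of_deep hGap hC)

/-- The same reduction with the census hypothesis already in DEEP form (`(S3δ)` at ten-deep sites
of an all-Good `2D`-ball, the form `(S3γ)` consumes): any multi-shell version of the link census
bridges into this one.  Pure application. [folklore] -/
theorem stub_fiveFoldLinear_of_deepParts :
    ((∀ (N : ℕ) (x : Fin N → EuclideanSpace ℝ (Fin 3)) (i j : Fin N), (∀ l : Fin N, dist (x i)
      (x l) ≤ 4 → ((∀ j' : Fin N, dist (x l) (x j') ≤ 11 / 10 → ∀ k : Fin N, k ≠ j' → (55 : ℝ) /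
      57 ≤ dist (x j') (x k)) ∧ (Finset.univ.filter fun j' : Fin N => j' ≠ l ∧ dist (x l) (x j')
      ≤ 1).card = 12 ∧ (Finset.univ.filter fun j' : Fin N => j' ≠ l ∧ dist (x l) (x j') ≤ 11 /
      10).card ≤ 12)) → 1 < dist (x i) (x j) → (131 : ℝ) / 100 ≤ dist (x i) (x j)) → ∀ (N : ℕ)
      (x : Fin N → EuclideanSpace ℝ (Fin 3)) (i : Fin N) (D : ℝ), (∀ j : Fin N, dist (x i) (x j)
      ≤ 2 * D → ((∀ j' : Fin N, dist (x j) (x j') ≤ 11 / 10 → ∀ k : Fin N, k ≠ j' → (55 : ℝ) /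
      57 ≤ dist (x j') (x k)) ∧ (Finset.univ.filter fun j' : Fin N => j' ≠ j ∧ dist (x j) (x j')
      ≤ 1).card = 12 ∧ (Finset.univ.filter fun j' : Fin N => j' ≠ j ∧ dist (x j) (x j') ≤ 11 /
      10).card ≤ 12)) → ∀ j k : Fin N, dist (x i) (x j) + 6 ≤ 2 * D → j ≠ k → dist (x j) (x k) ≤
      1 → ((Finset.univ.filter fun l : Fin N => l ≠ j ∧ l ≠ k ∧ dist (x j) (x l) ≤ 1 ∧ dist (x
      k) (x l) ≤ 1).card = 4 → (∑ l ∈ (Finset.univ.filter fun l : Fin N => l ≠ j ∧ l ≠ k ∧ dist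
      (x j) (x l) ≤ 1 ∧ dist (x k) (x l) ≤ 1), ((Finset.univ.filter fun l : Fin N => l ≠ j ∧ l ≠
      k ∧ dist (x j) (x l) ≤ 1 ∧ dist (x k) (x l) ≤ 1).filter fun l' : Fin N => l' ≠ l ∧ dist (x
      l) (x l') ≤ 1).card) = 4) ∧ ((Finset.univ.filter fun l : Fin N => l ≠ j ∧ l ≠ k ∧ dist (x
      j) (x l) ≤ 1 ∧ dist (x k) (x l) ≤ 1).card ≤ 4 → ∀ l ∈ (Finset.univ.filter fun l : Fin N =>
      l ≠ j ∧ l ≠ k ∧ dist (x j) (x l) ≤ 1 ∧ dist (x k) (x l) ≤ 1), ∀ l' ∈ (Finset.univ.filter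
      fun l : Fin N => l ≠ j ∧ l ≠ k ∧ dist (x j) (x l) ≤ 1 ∧ dist (x k) (x l) ≤ 1), 1 < dist (x
      l) (x l') → dist (x l) (x l') ≤ (38 : ℝ) / 25 → ∃ m m' : Fin N, dist (x m) (x m') ≤ 1 ∧ 1
      < dist (x j) (x m) ∧ dist (x k) (x m) ≤ 1 ∧ dist (x l) (x m) ≤ 1 ∧ dist (x l') (x m) ≤ 1 ∧
      1 < dist (x k) (x m') ∧ dist (x j) (x m') ≤ 1 ∧ dist (x l) (x m') ≤ 1 ∧ dist (x l') (x m')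
      ≤ 1)) →
    (∀ (N : ℕ) (x : Fin N → EuclideanSpace ℝ (Fin 3)) (i : Fin N) (D : ℝ), (∀ j : Fin N, dist
      (x i) (x j) ≤ 2 * D → ((∀ j' : Fin N, dist (x j) (x j') ≤ 11 / 10 → ∀ k : Fin N, k ≠ j' →
      (55 : ℝ) / 57 ≤ dist (x j') (x k)) ∧ (Finset.univ.filter fun j' : Fin N => j' ≠ j ∧ dist
      (x j) (x j') ≤ 1).card = 12 ∧ (Finset.univ.filter fun j' : Fin N => j' ≠ j ∧ dist (x j) (x
      j') ≤ 11 / 10).card ≤ 12)) → ∀ j : Fin N, dist (x i) (x j) + 10 ≤ 2 * D → ∃ e : Fin 12 →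
      Fin N, Function.Injective e ∧ (∀ a : Fin 12, e a ≠ j ∧ dist (x j) (x (e a)) ≤ 1) ∧ ((∀ a b
      : Fin 12, a ≠ b → (dist (x (e a)) (x (e b)) ≤ 1 ↔
      Literature.Geometry.DiscreteGeometry.fccAdj a b)) ∨ (∀ a b : Fin 12, a ≠ b → (dist (x (e
      a)) (x (e b)) ≤ 1 ↔ Literature.Geometry.DiscreteGeometry.hcpAdj a b)) ∨ (∀ a b : Fin 12, a
      ≠ b → (dist (x (e a)) (x (e b)) ≤ 1 ↔
      Summit.AtomisticToContinuum.Crystallization.Theorems.SquareWellLayerCakeGapTwelveToBarlow.bppAdj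
      a b = true)))) →
    ((∀ (N : ℕ) (x : Fin N → EuclideanSpace ℝ (Fin 3)) (i j : Fin N), (∀ l : Fin N, dist (x i)
      (x l) ≤ 4 → ((∀ j' : Fin N, dist (x l) (x j') ≤ 11 / 10 → ∀ k : Fin N, k ≠ j' → (55 : ℝ) /
      57 ≤ dist (x j') (x k)) ∧ (Finset.univ.filter fun j' : Fin N => j' ≠ l ∧ dist (x l) (x j')
      ≤ 1).card = 12 ∧ (Finset.univ.filter fun j' : Fin N => j' ≠ l ∧ dist (x l) (x j') ≤ 11 /
      10).card ≤ 12)) → 1 < dist (x i) (x j) → (131 : ℝ) / 100 ≤ dist (x i) (x j)) → (∀ (N : ℕ)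
      (x : Fin N → EuclideanSpace ℝ (Fin 3)) (i : Fin N) (D : ℝ), (∀ j : Fin N, dist (x i) (x j)
      ≤ 2 * D → ((∀ j' : Fin N, dist (x j) (x j') ≤ 11 / 10 → ∀ k : Fin N, k ≠ j' → (55 : ℝ) /
      57 ≤ dist (x j') (x k)) ∧ (Finset.univ.filter fun j' : Fin N => j' ≠ j ∧ dist (x j) (x j')
      ≤ 1).card = 12 ∧ (Finset.univ.filter fun j' : Fin N => j' ≠ j ∧ dist (x j) (x j') ≤ 11 /
      10).card ≤ 12)) → ∀ j k : Fin N, dist (x i) (x j) + 6 ≤ 2 * D → j ≠ k → dist (x j) (x k) ≤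
      1 → ((Finset.univ.filter fun l : Fin N => l ≠ j ∧ l ≠ k ∧ dist (x j) (x l) ≤ 1 ∧ dist (x
      k) (x l) ≤ 1).card = 4 → (∑ l ∈ (Finset.univ.filter fun l : Fin N => l ≠ j ∧ l ≠ k ∧ dist
      (x j) (x l) ≤ 1 ∧ dist (x k) (x l) ≤ 1), ((Finset.univ.filter fun l : Fin N => l ≠ j ∧ l ≠
      k ∧ dist (x j) (x l) ≤ 1 ∧ dist (x k) (x l) ≤ 1).filter fun l' : Fin N => l' ≠ l ∧ dist (x
      l) (x l') ≤ 1).card) = 4) ∧ ((Finset.univ.filter fun l : Fin N => l ≠ j ∧ l ≠ k ∧ dist (x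
      j) (x l) ≤ 1 ∧ dist (x k) (x l) ≤ 1).card ≤ 4 → ∀ l ∈ (Finset.univ.filter fun l : Fin N =>
      l ≠ j ∧ l ≠ k ∧ dist (x j) (x l) ≤ 1 ∧ dist (x k) (x l) ≤ 1), ∀ l' ∈ (Finset.univ.filter
      fun l : Fin N => l ≠ j ∧ l ≠ k ∧ dist (x j) (x l) ≤ 1 ∧ dist (x k) (x l) ≤ 1), 1 < dist (x
      l) (x l') → dist (x l) (x l') ≤ (38 : ℝ) / 25 → ∃ m m' : Fin N, dist (x m) (x m') ≤ 1 ∧ 1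
      < dist (x j) (x m) ∧ dist (x k) (x m) ≤ 1 ∧ dist (x l) (x m) ≤ 1 ∧ dist (x l') (x m) ≤ 1 ∧
      1 < dist (x k) (x m') ∧ dist (x j) (x m') ≤ 1 ∧ dist (x l) (x m') ≤ 1 ∧ dist (x l') (x m')
      ≤ 1)) → (∀ (N : ℕ) (x : Fin N → EuclideanSpace ℝ (Fin 3)) (i : Fin N) (D : ℝ), (∀ j : Fin
      N, dist (x i) (x j) ≤ 2 * D → ((∀ j' : Fin N, dist (x j) (x j') ≤ 11 / 10 → ∀ k : Fin N, k
      ≠ j' → (55 : ℝ) / 57 ≤ dist (x j') (x k)) ∧ (Finset.univ.filter fun j' : Fin N => j' ≠ j ∧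
      dist (x j) (x j') ≤ 1).card = 12 ∧ (Finset.univ.filter fun j' : Fin N => j' ≠ j ∧ dist (x
      j) (x j') ≤ 11 / 10).card ≤ 12)) → ∀ j : Fin N, dist (x i) (x j) + 10 ≤ 2 * D → ∃ e : Fin
      12 → Fin N, Function.Injective e ∧ (∀ a : Fin 12, e a ≠ j ∧ dist (x j) (x (e a)) ≤ 1) ∧
      ((∀ a b : Fin 12, a ≠ b → (dist (x (e a)) (x (e b)) ≤ 1 ↔
      Literature.Geometry.DiscreteGeometry.fccAdj a b)) ∨ (∀ a b : Fin 12, a ≠ b → (dist (x (e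
      a)) (x (e b)) ≤ 1 ↔ Literature.Geometry.DiscreteGeometry.hcpAdj a b)) ∨ (∀ a b : Fin 12, a
      ≠ b → (dist (x (e a)) (x (e b)) ≤ 1 ↔
      Summit.AtomisticToContinuum.Crystallization.Theorems.SquareWellLayerCakeGapTwelveToBarlow.bppAdj
      a b = true)))) → ∃ C D₀ : ℝ, ∀ (N : ℕ) (x : Fin N → EuclideanSpace ℝ (Fin 3)) (i : Fin N)
      (D : ℝ), D₀ ≤ D → (∀ j : Fin N, dist (x i) (x j) ≤ 2 * D → ((∀ j' : Fin N, dist (x j) (x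
      j') ≤ 11 / 10 → ∀ k : Fin N, k ≠ j' → (55 : ℝ) / 57 ≤ dist (x j') (x k)) ∧
      (Finset.univ.filter fun j' : Fin N => j' ≠ j ∧ dist (x j) (x j') ≤ 1).card = 12 ∧
      (Finset.univ.filter fun j' : Fin N => j' ≠ j ∧ dist (x j) (x j') ≤ 11 / 10).card ≤ 12)) →
      ((Finset.univ.filter fun j : Fin N => dist (x i) (x j) ≤ D ∧ ∃ k : Fin N, j ≠ k ∧ dist (x
      j) (x k) ≤ 1 ∧ (Finset.univ.filter fun l : Fin N => l ≠ j ∧ l ≠ k ∧ dist (x j) (x l) ≤ 1 ∧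
      dist (x k) (x l) ≤ 1).card = 5).card : ℝ) ≤ C * D) →
    (∀ (N : ℕ) (x : Fin N → EuclideanSpace ℝ (Fin 3)) (i j : Fin N), (∀ l : Fin N, dist (x i) (x
    l) ≤ 4 → ((∀ j' : Fin N, dist (x l) (x j') ≤ 11 / 10 → ∀ k : Fin N, k ≠ j' → (55 : ℝ) / 57 ≤
    dist (x j') (x k)) ∧ (Finset.univ.filter fun j' : Fin N => j' ≠ l ∧ dist (x l) (x j') ≤
    1).card = 12 ∧ (Finset.univ.filter fun j' : Fin N => j' ≠ l ∧ dist (x l) (x j') ≤ 11 /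
    10).card ≤ 12)) → 1 < dist (x i) (x j) → (131 : ℝ) / 100 ≤ dist (x i) (x j)) → (∀ (N : ℕ) (x
    : Fin N → EuclideanSpace ℝ (Fin 3)) (j k : Fin N), ((∀ j' : Fin N, dist (x j) (x j') ≤ 11 /
    10 → ∀ k' : Fin N, k' ≠ j' → (55 : ℝ) / 57 ≤ dist (x j') (x k')) ∧ (Finset.univ.filter fun
    j' : Fin N => j' ≠ j ∧ dist (x j) (x j') ≤ 1).card = 12 ∧ (Finset.univ.filter fun j' : Fin N
    => j' ≠ j ∧ dist (x j) (x j') ≤ 11 / 10).card ≤ 12) → (∀ l l' : Fin N, dist (x j) (x l) ≤ 1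
    → dist (x j) (x l') ≤ 1 → 1 < dist (x l) (x l') → (131 : ℝ) / 100 ≤ dist (x l) (x l')) → j ≠
    k → dist (x j) (x k) ≤ 1 → (Finset.univ.filter fun l : Fin N => l ≠ j ∧ l ≠ k ∧ dist (x j)
    (x l) ≤ 1 ∧ dist (x k) (x l) ≤ 1).card = 5 → (Finset.univ.filter fun k' : Fin N => k' ≠ j ∧
    dist (x j) (x k') ≤ 1 ∧ (Finset.univ.filter fun l : Fin N => l ≠ j ∧ l ≠ k' ∧ dist (x j) (x
    l) ≤ 1 ∧ dist (x k') (x l) ≤ 1).card = 5).card = 2 ∧ ∀ k' : Fin N, k' ≠ j → dist (x j) (x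
    k') ≤ 1 → (Finset.univ.filter fun l : Fin N => l ≠ j ∧ l ≠ k' ∧ dist (x j) (x l) ≤ 1 ∧ dist
    (x k') (x l) ≤ 1).card = 5 → k' ≠ k → inner ℝ (x k - x j) (x k' - x j) ≤ -((19 : ℝ) / 20) *
    (‖x k - x j‖ * ‖x k' - x j‖)) → ∃ C D₀ : ℝ, ∀ (N : ℕ) (x : Fin N → EuclideanSpace ℝ (Fin 3))
    (i : Fin N) (D : ℝ), D₀ ≤ D → (∀ j : Fin N, dist (x i) (x j) ≤ 2 * D → ((∀ j' : Fin N, dist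
    (x j) (x j') ≤ 11 / 10 → ∀ k : Fin N, k ≠ j' → (55 : ℝ) / 57 ≤ dist (x j') (x k)) ∧
    (Finset.univ.filter fun j' : Fin N => j' ≠ j ∧ dist (x j) (x j') ≤ 1).card = 12 ∧
    (Finset.univ.filter fun j' : Fin N => j' ≠ j ∧ dist (x j) (x j') ≤ 11 / 10).card ≤ 12)) →
    ((Finset.univ.filter fun j : Fin N => dist (x i) (x j) ≤ D ∧ ∃ k : Fin N, j ≠ k ∧ dist (x j)
    (x k) ≤ 1 ∧ (Finset.univ.filter fun l : Fin N => l ≠ j ∧ l ≠ k ∧ dist (x j) (x l) ≤ 1 ∧ dist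
    (x k) (x l) ≤ 1).card = 5).card : ℝ) ≤ C * D :=
  fun hβ hC hγ hGap _ => hγ hGap (hβ hGap) hC

end Summit.AtomisticToContinuum.Crystallization.Theorems.SquareWellLayerCakeGapTwelveToBarlow
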